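import Summits.ResolutionOfSingularities.ResolutionOfSingularities.Theses.FrobeniusLadder
import Summits.ResolutionOfSingularities.ResolutionOfSingularities.Theorems.FrobeniusLadderRegularStalksClimb
import Literature.RingTheory.TightClosure.RegularTightlyClosed
import Literature.AlgebraicGeometry.Resolution.RegularLocalRingsProofs
import Literature.AlgebraicGeometry.Resolution.NonReducedNoResolution

/-!
# `FInjectiveMacaulayfication` — negative lemmas: load-bearing hypotheses, and why no cheap
# counterexample exists (the summit implies the crux; dimension `≤ 3` is settled)

Support (negative) lemmas for crux `stmt-ResolutionOfSingularities-15315`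
(`Summit.ResolutionOfSingularities.ResolutionOfSingularities.Theses.FrobeniusLadder.FInjectiveMacaulayfication`:
for every prime `p`, every field `k` of characteristic `p` and every reduced separated `k`-scheme
`X` of finite type there is a proper birational `π : X' → X` such that every stalk of `X'` is a
domain in which every system of parameters is a weakly regular sequence generating a Frobenius
closed ideal — "F-injective Macaulayfication"), filed by the standing disprover (cdisprove gen 1;
work file `Cruxes/FInjectiveMacaulayfication/Disproof.lean`). This file declares NO definition;
every dropped-hypothesis variant of the crux is written out inline, verbatim from the route file.

* `exists_not_isDomain_stalk_of_isBirational_spec_dualNumber`,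
  `fInjectiveMacaulayfication_false_without_isReduced_at`,
  `fInjectiveMacaulayfication_false_without_isReduced` — with `IsReduced X` dropped the crux is
  FALSE at every prime: over `X = Spec 𝔽_p[ε]` (affine, of finite type) every birational
  `π : X' → X` restricts to an isomorphism over the one-point dense open, so some stalk of `X'` is
  `𝔽_p[ε]_{(ε)} ∋ ε/1 ≠ 0` with `(ε/1)² = 0` — not a domain, contradicting the first conjunct of
  the crux's per-stalk clause. (Any proof must use reducedness; it enters exactly through
  "locally integral".)
* `exists_stalk_ringEquiv_of_isBirational_spec_field`, `fInjectiveMacaulayfication_false_without_prime`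
  — with `p.Prime` dropped the statement is (junk-)FALSE, at `p = 0`, `k = ℚ`, `X = Spec ℚ`: the
  inline Frobenius clause reads `y ^ 0 ^ 1 = 1 ∈ span {z ^ 0} = ⊤ ⇒ y ∈ (s)` and forces every
  parameter ideal of every stalk of `X'` to be `⊤`; at the stalk `≅ ℚ` (`d = 0`, `s = ()`,
  `(s) = ⊥` with maximal radical) this says `1 ∈ ⊥`. So `p.Prime` is load-bearing only through
  the junk value `p = 0` of the inline clause (no field has characteristic `1`); it carries no
  mathematical content a prover could exploit.
* `charP_stalk`, `rung_of_isRegular`, `conclusion_of_hasResolution` — **WHY THE CRUX RESISTS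
  DISPROOF: a refutation of the crux is a refutation of the summit.** A resolution of
  singularities IS an F-injective Macaulayfication (`conclusion_of_hasResolution`:
  `Scheme.HasResolution X →` the crux's conclusion for `X`): regular local rings are domains
  (Matsumura 14.3, `isDomain_of_isRegularLocalRing`), their systems of parameters are regular
  sequences (route support item `RegularStalksClimb`, proved in the tree as
  `RegularStalksClimb_proof`, Matsumura 17.4), and all their ideals are Frobenius closed (Kunz's
  flatness of Frobenius, `isFrobeniusClosed_of_isRegularLocalRing`, Huneke–Swanson 13.1.2 (6));
  stalks of a `k`-scheme have characteristic `p` (`charP_stalk`). (The one-line corollary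
  `¬ crux → ¬ ResolutionOfSingularities` is kept in the work file `Disproof.lean` only, so that
  this file mentions no summit statement.)
* `conclusion_of_dim_le_three` — **modulo the named fact `CossartPiltant2019` the crux's
  conclusion holds for every admissible `X` of dimension `≤ 3`**: a counterexample to the crux is
  a reduced variety of dimension `≥ 4` over a field of positive characteristic without ANY proper
  birational Cohen–Macaulay F-injective locally-integral model — in particular without a
  resolution; none is in print (the planner's zbMATH/arXiv sweep of 2026-08-16 and the disprover's
  of the same day found no "F-injective modification" existence or non-existence result beyond
  Macaulayfication itself, arXiv:1810.04493 Thm. 1.6).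

Hypotheses NOT shown load-bearing here (see `Disproof.lean` §2 for the discussion):
`LocallyOfFiniteType f` (the absolute integral closure `Spec 𝔽_p[X]⁺` used for the sibling cruxes
is NOT a witness: being a perfect normal domain of dimension one it satisfies the per-stalk clause
with `X' = X`; a witness would be a non-CM-quasi-excellent local domain à la Ferrand–Raynaud, not
formalised), `IsSeparated f` and `QuasiCompact f` (probably removable, as for resolution itself).

## Sources
* H. Matsumura, *Commutative Ring Theory*, CUP 1986, Thm. 14.3, Thm. 17.4.
* C. Huneke, I. Swanson, *Integral Closure of Ideals, Rings, and Modules*, CUP 2006, Thm. 13.1.2 (6).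
* E. Kunz, Amer. J. Math. 91 (1969), Thm. 2.1 (tree: `Kunz1969_holds`).
* V. Cossart, O. Piltant, J. Algebra 529 (2019), Thm. 1.1 (named fact `CossartPiltant2019`).
* K. Česnavičius, *Macaulayfication of Noetherian schemes*, Duke Math. J. 170 (2021) =
  arXiv:1810.04493, Thm. 1.6 (the rung below; nearest printed existence theorem).
* The Stacks Project, Tag 01RN (birational morphisms).
-/

noncomputable section

open CategoryTheory AlgebraicGeometry TopologicalSpace
open Literature.AlgebraicGeometry.Resolution Literature.RingTheory.TightClosure
open Summit.ResolutionOfSingularities.ResolutionOfSingularities.Theses.FrobeniusLadder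

set_option linter.dupNamespace false

namespace Summit.ResolutionOfSingularities.ResolutionOfSingularities.Theorems.FInjectiveMacaulayfication.Negative

universe u

/-! ## `IsReduced X` is load-bearing -/

/-- **No birational `π : X' ⟶ Spec k[ε]` has a source all of whose stalks are domains**: the dense
open `U` of `IsBirational` contains the unique point, `π⁻¹U ≅ U`, and the stalk of `Spec k[ε]`
there is a localisation of `k[ε]` in which `ε/1` is a non-zero nilpotent (an element killing `ε`
lies in every prime, `DualNumber.mem_of_mul_eps_eq_zero`). [folklore] -/
theorem exists_not_isDomain_stalk_of_isBirational_spec_dualNumber (k : Type u) [Field k]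
    {X' : Scheme.{u}} (π : X' ⟶ Spec (.of (DualNumber k))) (hπ : IsBirational π) :
    ∃ x : X', ¬ IsDomain (X'.presheaf.stalk x) := by
  obtain ⟨U, hUd, -, hUiso⟩ := hπ
  haveI := hUiso
  obtain ⟨x, hx⟩ := hUd.nonempty
  let u : (U : Scheme.{u}) := ⟨x, hx⟩
  let e := asIso (π ∣_ U)
  let v := e.inv.base u
  refine ⟨(π ⁻¹ᵁ U).ι.base v, fun h1 => ?_⟩
  have h2 : IsDomain ((↑(π ⁻¹ᵁ U) : Scheme.{u}).presheaf.stalk v) :=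
    MulEquiv.isDomain _ (asIso ((π ⁻¹ᵁ U).ι.stalkMap v)).commRingCatIsoToRingEquiv.symm.toMulEquiv
  have h3 : IsDomain ((U : Scheme.{u}).presheaf.stalk u) :=
    MulEquiv.isDomain _ (asIso (e.inv.stalkMap u)).commRingCatIsoToRingEquiv.symm.toMulEquiv
  have h4 : IsDomain ((Spec (.of (DualNumber k))).presheaf.stalk x) :=
    MulEquiv.isDomain _ (asIso (U.ι.stalkMap u)).commRingCatIsoToRingEquiv.toMulEquiv
  haveI : IsDomain (Localization.AtPrime x.asIdeal) :=
    MulEquiv.isDomain _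
      (Spec.stalkIso (.of (DualNumber k)) x).commRingCatIsoToRingEquiv.symm.toMulEquiv
  have hε : algebraMap (DualNumber k) (Localization.AtPrime x.asIdeal) DualNumber.eps = 0 := by
    have h2 : (algebraMap (DualNumber k) (Localization.AtPrime x.asIdeal) DualNumber.eps) ^ 2 = 0 := by
      rw [← map_pow, pow_two, DualNumber.eps_mul_eps, map_zero]
    exact (pow_eq_zero_iff two_ne_zero).mp h2
  obtain ⟨⟨s, hs⟩, hsε⟩ :=
    (IsLocalization.map_eq_zero_iff x.asIdeal.primeCompl (Localization.AtPrime x.asIdeal) _).mp hε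
  exact (Ideal.mem_primeCompl_iff.mp hs) (DualNumber.mem_of_mul_eps_eq_zero x.asIdeal hsε)

/-- **At every prime, the crux with `IsReduced X` dropped fails** (the body below is the route's
`FInjectiveMacaulayfication` at a fixed prime `p` with the hypothesis `IsReduced X` deleted):
witness `Spec 𝔽_p[ε] → Spec 𝔽_p` (affine, hence separated and quasi-compact; of finite type).
[folklore] -/
theorem fInjectiveMacaulayfication_false_without_isReduced_at (p : ℕ) [Fact p.Prime] :
    ¬ ∀ (k : Type) [Field k] [CharP k p] (X : Scheme.{0}) (f : X ⟶ Spec (.of k)),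
      IsSeparated f → LocallyOfFiniteType f → QuasiCompact f →
      ∃ (X' : Scheme.{0}) (π : X' ⟶ X), IsProper π ∧ IsBirational π ∧ ∀ x : X',
        IsDomain (X'.presheaf.stalk x) ∧ ∀ d : ℕ, ringKrullDim (X'.presheaf.stalk x) = d →
          ∀ s : Fin d → X'.presheaf.stalk x, (Ideal.span (Set.range s)).radical.IsMaximal →
            RingTheory.Sequence.IsWeaklyRegular (X'.presheaf.stalk x) (List.ofFn s) ∧
            ∀ y : X'.presheaf.stalk x, (∃ e : ℕ, y ^ p ^ e ∈ Ideal.span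
              ((fun z : X'.presheaf.stalk x => z ^ p ^ e) ''
                (Ideal.span (Set.range s) : Set (X'.presheaf.stalk x)))) →
              y ∈ Ideal.span (Set.range s) := by
  intro h
  haveI : Module.Finite (ZMod p) (DualNumber (ZMod p)) :=
    inferInstanceAs (Module.Finite (ZMod p) (ZMod p × ZMod p))
  let f : Spec (.of (DualNumber (ZMod p))) ⟶ Spec (.of (ZMod p)) :=
    Spec.map (CommRingCat.ofHom (algebraMap (ZMod p) (DualNumber (ZMod p))))
  haveI : LocallyOfFiniteType f :=
    (HasRingHomProperty.Spec_iff (P := @LocallyOfFiniteType)).mpr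
      (RingHom.finiteType_algebraMap.mpr inferInstance)
  obtain ⟨X', π, -, hπ, hx⟩ :=
    h (ZMod p) (Spec (.of (DualNumber (ZMod p)))) f inferInstance inferInstance inferInstance
  obtain ⟨x, hx'⟩ := exists_not_isDomain_stalk_of_isBirational_spec_dualNumber (ZMod p) π hπ
  exact hx' (hx x).1

/-- **Any proof of `FInjectiveMacaulayfication` must use `IsReduced X`**: the crux with that
hypothesis dropped (everything else verbatim) is false, already at `p = 2`. [folklore] -/
theorem fInjectiveMacaulayfication_false_without_isReduced :
    ¬ ∀ p : ℕ, p.Prime → ∀ (k : Type) [Field k] [CharP k p] (X : Scheme.{0})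
      (f : X ⟶ Spec (.of k)), IsSeparated f → LocallyOfFiniteType f → QuasiCompact f →
      ∃ (X' : Scheme.{0}) (π : X' ⟶ X), IsProper π ∧ IsBirational π ∧ ∀ x : X',
        IsDomain (X'.presheaf.stalk x) ∧ ∀ d : ℕ, ringKrullDim (X'.presheaf.stalk x) = d →
          ∀ s : Fin d → X'.presheaf.stalk x, (Ideal.span (Set.range s)).radical.IsMaximal →
            RingTheory.Sequence.IsWeaklyRegular (X'.presheaf.stalk x) (List.ofFn s) ∧
            ∀ y : X'.presheaf.stalk x, (∃ e : ℕ, y ^ p ^ e ∈ Ideal.span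
              ((fun z : X'.presheaf.stalk x => z ^ p ^ e) ''
                (Ideal.span (Set.range s) : Set (X'.presheaf.stalk x)))) →
              y ∈ Ideal.span (Set.range s) := fun h =>
  haveI : Fact (Nat.Prime 2) := ⟨Nat.prime_two⟩
  fInjectiveMacaulayfication_false_without_isReduced_at 2 (h 2 Nat.prime_two)

/-! ## `p.Prime` enters only through the junk value `p = 0` of the inline Frobenius clause -/

/-- Over a birational `π : X' ⟶ Spec K` (`K` a field) some stalk of `X'` is ring-isomorphic to `K`
(transport along `π⁻¹U ≅ U`, the open immersions, `Spec.stalkIso` and `K ≅ K_{(0)}`). [folklore] -/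
theorem exists_stalk_ringEquiv_of_isBirational_spec_field (K : Type u) [Field K]
    {X' : Scheme.{u}} (π : X' ⟶ Spec (.of K)) (hπ : IsBirational π) :
    ∃ x : X', Nonempty (X'.presheaf.stalk x ≃+* K) := by
  obtain ⟨U, hUd, -, hUiso⟩ := hπ
  haveI := hUiso
  obtain ⟨x, hx⟩ := hUd.nonempty
  let u : (U : Scheme.{u}) := ⟨x, hx⟩
  let e := asIso (π ∣_ U)
  let v := e.inv.base u
  refine ⟨(π ⁻¹ᵁ U).ι.base v, ⟨?_⟩⟩
  have hM : x.asIdeal.primeCompl ≤ IsUnit.submonoid K := fun s hs =>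
    (Ne.isUnit fun h0 => (Ideal.mem_primeCompl_iff.mp hs) (h0 ▸ x.asIdeal.zero_mem))
  exact (asIso ((π ⁻¹ᵁ U).ι.stalkMap v)).commRingCatIsoToRingEquiv.trans <|
    (asIso (e.inv.stalkMap u)).commRingCatIsoToRingEquiv.trans <|
    (asIso (U.ι.stalkMap u)).commRingCatIsoToRingEquiv.symm.trans <|
    (Spec.stalkIso (.of K) x).commRingCatIsoToRingEquiv.trans
    (IsLocalization.atUnits K x.asIdeal.primeCompl hM
      (S := Localization.AtPrime x.asIdeal)).toRingEquiv.symm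

/-- **The crux with `p.Prime` dropped is (junk-)false** (the body below is the route's
`FInjectiveMacaulayfication` with `p.Prime →` deleted): at `p = 0`, `k = ℚ`, `X = Spec ℚ`
(affine, reduced, of finite type) the clause `y ^ 0 ^ 1 ∈ span {z ^ 0 ^ 1 | z ∈ (s)}` holds for
every `y` (`0 ^ 1 = 0`, `y ^ 0 = 1 = 0 ^ 0`), so the consequent demands `1 ∈ (s) = ⊥` at the
zero-dimensional stalk `≅ ℚ`. No mathematical content: `p.Prime` only excludes this degenerate
reading (a field has prime or zero characteristic). [folklore] -/
theorem fInjectiveMacaulayfication_false_without_prime :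
    ¬ ∀ (p : ℕ) (k : Type) [Field k] [CharP k p] (X : Scheme.{0}) (f : X ⟶ Spec (.of k)),
      IsSeparated f → LocallyOfFiniteType f → QuasiCompact f → IsReduced X →
      ∃ (X' : Scheme.{0}) (π : X' ⟶ X), IsProper π ∧ IsBirational π ∧ ∀ x : X',
        IsDomain (X'.presheaf.stalk x) ∧ ∀ d : ℕ, ringKrullDim (X'.presheaf.stalk x) = d →
          ∀ s : Fin d → X'.presheaf.stalk x, (Ideal.span (Set.range s)).radical.IsMaximal →
            RingTheory.Sequence.IsWeaklyRegular (X'.presheaf.stalk x) (List.ofFn s) ∧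
            ∀ y : X'.presheaf.stalk x, (∃ e : ℕ, y ^ p ^ e ∈ Ideal.span
              ((fun z : X'.presheaf.stalk x => z ^ p ^ e) ''
                (Ideal.span (Set.range s) : Set (X'.presheaf.stalk x)))) →
              y ∈ Ideal.span (Set.range s) := by
  intro h
  obtain ⟨X', π, -, hbir, hx⟩ := h 0 ℚ (Spec (.of ℚ)) (𝟙 _)
    inferInstance inferInstance inferInstance inferInstance
  obtain ⟨x, ⟨E⟩⟩ := exists_stalk_ringEquiv_of_isBirational_spec_field ℚ π hbir
  haveI : Nontrivial (X'.presheaf.stalk x) := E.symm.injective.nontrivial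
  obtain ⟨hdom, hx⟩ := hx x
  have hdim : ringKrullDim (X'.presheaf.stalk x) = (0 : ℕ) := by
    rw [ringKrullDim_eq_of_ringEquiv E, Nat.cast_zero]
    exact ringKrullDim_eq_zero_of_field ℚ
  have hbot : Ideal.span (Set.range (Fin.elim0 : Fin 0 → X'.presheaf.stalk x)) = ⊥ := by
    rw [Set.range_eq_empty, Ideal.span_empty]
  have hrad : (⊥ : Ideal (X'.presheaf.stalk x)).radical = ⊥ := by
    change nilradical (X'.presheaf.stalk x) = ⊥
    exact nilradical_eq_zero _
  have hmax : (Ideal.span (Set.range (Fin.elim0 : Fin 0 → X'.presheaf.stalk x))).radical.IsMaximal := by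
    rw [hbot, hrad, ← Ideal.comap_bot_of_injective E.toRingHom E.injective]
    exact Ideal.comap_isMaximal_of_surjective E.toRingHom E.surjective
  have key := (hx 0 hdim Fin.elim0 hmax).2 1 ⟨1, ?_⟩
  · rw [hbot] at key
    exact one_ne_zero (Ideal.mem_bot.mp key)
  · refine Ideal.subset_span ⟨0, Submodule.zero_mem _, ?_⟩
    simp

/-! ## Why the crux resists disproof: the summit implies it, and dimension `≤ 3` is settled -/

/-- Stalks of a scheme over a field of characteristic `p ≠ 0` have characteristic `p` (the
structure map `k → Γ(X, 𝒪_X) → 𝒪_{X,x}` is a ring map from a field into a non-zero ring).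
[folklore] -/
theorem charP_stalk {k : Type} [Field k] {p : ℕ} [CharP k p] (hp : p ≠ 0) {Y : Scheme.{0}}
    (g : Y ⟶ Spec (.of k)) (y : Y) : CharP (Y.presheaf.stalk y) p :=
  CharP.of_ringHom_of_ne_zero
    ((Y.presheaf.germ ⊤ y trivial).hom.comp (g.appTop.hom.comp (Scheme.ΓSpecIso (.of k)).inv.hom))
    p hp

/-- **The per-stalk clause of the crux holds at every point of a REGULAR scheme over a field of
characteristic `p`**: a regular local ring is a domain (Matsumura 14.3), its systems of parameters
are regular sequences (`RegularStalksClimb_proof`, Matsumura 17.4) and its ideals are Frobenius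
closed (Kunz; Huneke–Swanson 13.1.2 (6)). [cite: Matsumura1987, Thm. 14.3 and Thm. 17.4;
HunekeSwanson2006, Thm. 13.1.2 (6)] -/
theorem rung_of_isRegular {p : ℕ} (hp : p.Prime) {k : Type} [Field k] [CharP k p]
    {Y : Scheme.{0}} (g : Y ⟶ Spec (.of k)) (hY : Scheme.IsRegular Y) (x : Y) :
    IsDomain (Y.presheaf.stalk x) ∧ ∀ d : ℕ, ringKrullDim (Y.presheaf.stalk x) = d →
      ∀ s : Fin d → Y.presheaf.stalk x, (Ideal.span (Set.range s)).radical.IsMaximal →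
        RingTheory.Sequence.IsWeaklyRegular (Y.presheaf.stalk x) (List.ofFn s) ∧
        ∀ y : Y.presheaf.stalk x, (∃ e : ℕ, y ^ p ^ e ∈ Ideal.span
          ((fun z : Y.presheaf.stalk x => z ^ p ^ e) ''
            (Ideal.span (Set.range s) : Set (Y.presheaf.stalk x)))) →
          y ∈ Ideal.span (Set.range s) := by
  haveI : Fact p.Prime := ⟨hp⟩
  haveI : IsRegularLocalRing (Y.presheaf.stalk x) := hY x
  haveI : CharP (Y.presheaf.stalk x) p := charP_stalk hp.ne_zero g x
  haveI : IsDomain (Y.presheaf.stalk x) := isDomain_of_isRegularLocalRing _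
  refine ⟨inferInstance, fun d hd s hs => ⟨?_, ?_⟩⟩
  · exact (Summit.ResolutionOfSingularities.ResolutionOfSingularities.Theorems.RegularStalksClimb_proof
      p hp (Y.presheaf.stalk x) inferInstance d hd s hs).1
  · exact (isFrobeniusClosed_iff p).mp (isFrobeniusClosed_of_isRegularLocalRing p _)

/-- **A resolution of singularities is an F-injective Macaulayfication**: if `X → Spec k`
(`char k = p` prime) has a resolution then the crux's conclusion holds for `X` (same `X'`, same
`π`). [folklore] -/
theorem conclusion_of_hasResolution {p : ℕ} (hp : p.Prime) {k : Type} [Field k] [CharP k p]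
    {X : Scheme.{0}} (f : X ⟶ Spec (.of k)) (h : Scheme.HasResolution X) :
    ∃ (X' : Scheme.{0}) (π : X' ⟶ X), IsProper π ∧ IsBirational π ∧ ∀ x : X',
      IsDomain (X'.presheaf.stalk x) ∧ ∀ d : ℕ, ringKrullDim (X'.presheaf.stalk x) = d →
        ∀ s : Fin d → X'.presheaf.stalk x, (Ideal.span (Set.range s)).radical.IsMaximal →
          RingTheory.Sequence.IsWeaklyRegular (X'.presheaf.stalk x) (List.ofFn s) ∧
          ∀ y : X'.presheaf.stalk x, (∃ e : ℕ, y ^ p ^ e ∈ Ideal.span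
            ((fun z : X'.presheaf.stalk x => z ^ p ^ e) ''
              (Ideal.span (Set.range s) : Set (X'.presheaf.stalk x)))) →
            y ∈ Ideal.span (Set.range s) := by
  obtain ⟨X', π, hπ⟩ := h
  exact ⟨X', π, hπ.isProper, hπ.isBirational, rung_of_isRegular hp (π ≫ f) hπ.isRegular⟩

/-- **Shape of a minimal counterexample — dimension `≥ 4`**: modulo the named fact
`CossartPiltant2019` (resolution in dimension `≤ 3`, all characteristics) the crux's conclusion
holds for every reduced separated `X` of finite type of dimension `≤ 3` over a field of prime
characteristic `p`. [cite: CossartPiltant2019, Thm. 1.1] -/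
theorem conclusion_of_dim_le_three (hCP : CossartPiltant2019.{0}) {p : ℕ} (hp : p.Prime)
    (k : Type) [Field k] [CharP k p] (X : Scheme.{0}) (f : X ⟶ Spec (.of k)) [IsSeparated f]
    [LocallyOfFiniteType f] [QuasiCompact f] [IsReduced X] (hdim : topologicalKrullDim X ≤ 3) :
    ∃ (X' : Scheme.{0}) (π : X' ⟶ X), IsProper π ∧ IsBirational π ∧ ∀ x : X',
      IsDomain (X'.presheaf.stalk x) ∧ ∀ d : ℕ, ringKrullDim (X'.presheaf.stalk x) = d →
        ∀ s : Fin d → X'.presheaf.stalk x, (Ideal.span (Set.range s)).radical.IsMaximal →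
          RingTheory.Sequence.IsWeaklyRegular (X'.presheaf.stalk x) (List.ofFn s) ∧
          ∀ y : X'.presheaf.stalk x, (∃ e : ℕ, y ^ p ^ e ∈ Ideal.span
            ((fun z : X'.presheaf.stalk x => z ^ p ^ e) ''
              (Ideal.span (Set.range s) : Set (X'.presheaf.stalk x)))) →
            y ∈ Ideal.span (Set.range s) :=
  conclusion_of_hasResolution hp f (hasResolution_of_dim_le_three hCP k X f hdim)

end Summit.ResolutionOfSingularities.ResolutionOfSingularities.Theorems.FInjectiveMacaulayfication.Negative

end
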